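import Literature.Analysis.FluidPDE.CollisionalTransfer
import Literature.Analysis.FluidPDE.HardSphereFlowJointMeasurable
import HarnessLib

/-!
# The collisional transfer along a hard-sphere flow is measurable in the initial datum

The time-integrated collisional transfer of an observable `F` along the orbit of a datum `z`
under a hard-sphere flow `Φ` over the window `(0, h]`,
`W_F(z, h) = Φ.collisionalTransfer F z h` (`Literature.Analysis.FluidPDE.CollisionalTransfer`;
instances: the collisional momentum transfer `W_J(z, h) = Φ.momentumTransfer J z h =
Σ_{t_c ≤ h} ⟪J(x_i(t_c)) - J(x_j(t_c)), v_i(t_c⁺) - v_i(t_c⁻)⟫` against a vector test field `J`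
and the collisional energy transfer `W^e_ϑ(z, h) = Φ.energyTransfer ϑ z h` against a scalar test
field `ϑ`), is the functional of the initial datum that hydrodynamic-limit statements integrate
against a law on phase space — typically through exponential moments
`∫ exp(h⁻¹ W_J(z, h)) dG_N(z)` of window-integrated currents (Olla–Varadhan–Yau 1993 §3;
Spohn 1991 Part I §3.2). This file supplies the one piece of its basic API that
`CollisionalTransfer` deliberately left open: **measurability in `z`**.

* `HardSphereFlow.measurable_collisionalTransfer_comp_subtype` — for an observable `F` with a
  streaming derivative `F'` along free flight (`F` measurable, `F'` strongly measurable),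
  `z ↦ W_F(z, h)` is measurable on the good set `Φ.good` (Hausdorff, metrizable,
  second-countable Borel position space with continuous translations: `ℝ^d`, `T^d`).
  Proof: the weak balance law `F(Φ_h z) - F(z) = ∫_0^h F'(Φ_s z) ds + W_F(z, h)`
  (`HardSphereFlow.sub_eq_integral_add_collisionalTransfer`) expresses `W_F` through point
  evaluations of the flow and a window integral along the flow, which is measurable on the good
  set by the joint measurability of `(z, s) ↦ Φ_s z` there
  (`HardSphereFlow.stronglyMeasurable_integral_comp_flow`); for `h ≤ 0` the window is empty.
* `HardSphereFlow.measurable_indicator_collisionalTransfer` — the same function extended by `0`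
  off the good set is measurable on the whole phase space;
  `HardSphereFlow.aemeasurable_collisionalTransfer` /
  `HardSphereFlow.aestronglyMeasurable_collisionalTransfer` — a.e.-(strong) measurability under
  every measure carried by the good set (`μ Φ.goodᶜ = 0`), in particular under the Liouville
  measure and every law absolutely continuous with respect to it
  (`…_of_absolutelyContinuous`, `…_liouville`).
* On the flat torus `T^d`, for `C¹` test fields and with no side condition left:
  `HardSphereFlow.measurable_momentumTransfer_comp_subtype_torus`,
  `HardSphereFlow.measurable_indicator_momentumTransfer_torus`,
  `HardSphereFlow.aemeasurable_momentumTransfer_torus` (+ `_liouville`), and the energy twins.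

## Mathlib / Literature reuse

`Measurable.dite`, `MeasureTheory.StronglyMeasurable.integral_prod_right'` (through
`HardSphereFlow.stronglyMeasurable_integral_comp_flow`), `Measure.AbsolutelyContinuous` are
Mathlib's; the balance laws and the streaming terms are `CollisionalTransfer`
(`sub_eq_integral_add_collisionalTransfer`, `momentumObservable_sub_eq_torus`,
`energyObservable_sub_eq_torus`, `continuous_momentumStreaming`, `continuous_energyStreaming`),
the joint measurability of the flow on its good set is `HardSphereFlowJointMeasurable`.
The requested notion "collisional transfer along the flow" itself is NOT redefined here: it is
`HardSphereFlow.collisionalTransfer` / `momentumTransfer` / `energyTransfer` of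
`CollisionalTransfer` (jump form) and `HardSphereFlow.collisionalTransferFunctional` /
`collisionalMomentumTransfer` / `collisionalStress` / `collisionalVirial` /
`collisionalEnergyTransfer` of `CollisionalTransferFunctional` (collision-indexed form).

## Design choices

* Results come in the three currencies used by the neighbouring files: measurable on the
  subtype `Φ.good` (where the flow is meaningful), measurable after extension by `0`
  (`Set.indicator Φ.good`, as in `EmpiricalCollisionMeasureMeasurable`), and a.e.-measurable for
  laws carried by the good set (as in `HardSphereFlowJointMeasurable`).
* The balance-law argument needs a streaming derivative, i.e. `C¹` test fields on the torus —
  exactly the generality of the balance laws the transfer is used with. Measurability for merely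
  continuous test fields, and for the collision-indexed functionals that are not jumps of an
  observable (collisional stress, virial), goes instead through the velocity-jump detection of
  `EmpiricalCollisionMeasureMeasurable` and is deliberately NOT here.

## References

* S. Olla, S. R. S. Varadhan, H.-T. Yau, *Hydrodynamical limit for a Hamiltonian system with
  weak noise*, Comm. Math. Phys. 155 (1993), §3 (exponential moments of time-integrated
  microscopic currents).
* H. Spohn, *Large Scale Dynamics of Interacting Particles*, Springer (1991), Part I §3.2,
  (3.6)–(3.8).
* C. Cercignani, R. Illner, M. Pulvirenti, *The Mathematical Theory of Dilute Gases* (1994),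
  §4.2, App. 4.A (the hard-sphere flow as a measurable dynamical system).
-/

open Set Filter Function
open _root_.MeasureTheory _root_.Topology
open scoped InnerProductSpace

namespace Literature.Analysis.FluidPDE

noncomputable section

section Kinetic

variable {d : Type*} [Fintype d] {X : Type*} {N : ℕ}
variable [MeasureSpace X] [TopologicalSpace X] {G : Geometry d X} {ε : ℝ}

namespace HardSphereFlow

/-! ## Glue: from the good subtype to the phase space -/

/-- A function on phase space whose restriction to the good set is measurable becomes
measurable on the whole phase space once extended by `0` off the good set (the good set is
measurable). [folklore] -/
theorem measurable_indicator_of_measurable_comp_subtype {β : Type*} [MeasurableSpace β] [Zero β]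
    (Φ : HardSphereFlow G ε N) {g : Config N d X → β} (hg : Measurable fun z : Φ.good => g z) :
    Measurable (Φ.good.indicator g) := by
  classical
  have heq : Φ.good.indicator g = fun z => if hz : z ∈ Φ.good then g z else 0 := by
    funext z
    by_cases hz : z ∈ Φ.good
    · simp [hz]
    · simp [hz]
  rw [heq]
  exact Measurable.dite hg measurable_const Φ.measurableSet_good

/-- Over a window `(0, h]` with `h ≤ 0` (empty) the collisional transfer along the flow vanishes
identically. [folklore] -/
theorem collisionalTransfer_of_nonpos {E : Type*} [NormedAddCommGroup E] (Φ : HardSphereFlow G ε N)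
    (F : Config N d X → E) (z : Config N d X) {h : ℝ} (hh : h ≤ 0) :
    Φ.collisionalTransfer F z h = 0 :=
  collisionalTransfer_eq_zero_of_forall_not_mem F fun _ hτ _ => (not_lt.2 hh (hτ.1.trans_le hτ.2)).elim

/-! ## Measurability of the collisional transfer of an observable -/

section Observable

variable {E : Type*} [NormedAddCommGroup E] [NormedSpace ℝ E] [CompleteSpace E]
  [MeasurableSpace E] [BorelSpace E] [SecondCountableTopology E]

/-- **The collisional transfer along the flow is measurable in the datum on the good set.**
Let the observable `F` (measurable) have the streaming derivative `F'` (strongly measurable)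
along free flight, `d/dt F(S_t z) = F'(S_t z)` with `t ↦ F'(S_t z)` continuous. Then for every
window length `h` the map `z ↦ W_F(z, h) = Φ.collisionalTransfer F z h` is measurable on
`Φ.good` (Hausdorff, metrizable, second-countable Borel position space, continuous translations).
By the weak balance law `W_F(z, h) = F(Φ_h z) - F(z) - ∫_0^h F'(Φ_s z) ds` on the good set, and
the window integral is measurable there by the joint measurability of the flow. [folklore] -/
theorem measurable_collisionalTransfer_comp_subtype [T2Space X]
    [TopologicalSpace.PseudoMetrizableSpace X] [SecondCountableTopology X] [BorelSpace X]
    (Φ : HardSphereFlow G ε N) (hG : ∀ x : X, Continuous (G.translate x))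
    {F F' : Config N d X → E}
    (hF : ∀ z t, HasDerivAt (fun s => F (freeFlight G s z)) (F' (freeFlight G t z)) t)
    (hF' : ∀ z, Continuous fun t => F' (freeFlight G t z)) (hFm : Measurable F)
    (hF'm : StronglyMeasurable F') (h : ℝ) :
    Measurable fun z : Φ.good => Φ.collisionalTransfer F z h := by
  rcases le_or_gt h 0 with hh | hh
  · have : (fun z : Φ.good => Φ.collisionalTransfer F z h) = fun _ => 0 := by
      funext z
      exact Φ.collisionalTransfer_of_nonpos F z hh
    rw [this]
    exact measurable_const
  · have heq : (fun z : Φ.good => Φ.collisionalTransfer F z h) = fun z : Φ.good =>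
        F (Φ.flow h z) - F z - ∫ s in 0..h, F' (Φ.flow s z) := by
      funext z
      have hbal := (Φ.sub_eq_integral_add_collisionalTransfer hG hF hF' z.2 hh.le).2
      rw [hbal]
      abel
    rw [heq]
    have h1 : Measurable fun z : Φ.good => F (Φ.flow h z) :=
      hFm.comp ((Φ.measurable_flow h).comp measurable_subtype_coe)
    have h2 : Measurable fun z : Φ.good => F (z : Config N d X) := hFm.comp measurable_subtype_coe
    have h3 : Measurable fun z : Φ.good => ∫ s in 0..h, F' (Φ.flow s z) := by
      have i1 := (Φ.stronglyMeasurable_integral_comp_flow hG hF'm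
        (volume.restrict (Ioc 0 h))).measurable
      have i2 := (Φ.stronglyMeasurable_integral_comp_flow hG hF'm
        (volume.restrict (Ioc h 0))).measurable
      simp only [intervalIntegral]
      exact i1.sub i2
    exact (h1.sub h2).sub h3

/-- The collisional transfer along the flow, extended by `0` off the good set, is a measurable
function of the datum on the whole phase space (hypotheses of
`measurable_collisionalTransfer_comp_subtype`). [folklore] -/
theorem measurable_indicator_collisionalTransfer [T2Space X]
    [TopologicalSpace.PseudoMetrizableSpace X] [SecondCountableTopology X] [BorelSpace X]
    (Φ : HardSphereFlow G ε N) (hG : ∀ x : X, Continuous (G.translate x))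
    {F F' : Config N d X → E}
    (hF : ∀ z t, HasDerivAt (fun s => F (freeFlight G s z)) (F' (freeFlight G t z)) t)
    (hF' : ∀ z, Continuous fun t => F' (freeFlight G t z)) (hFm : Measurable F)
    (hF'm : StronglyMeasurable F') (h : ℝ) :
    Measurable (Φ.good.indicator fun z => Φ.collisionalTransfer F z h) :=
  Φ.measurable_indicator_of_measurable_comp_subtype
    (Φ.measurable_collisionalTransfer_comp_subtype hG hF hF' hFm hF'm h)

/-- **A.e.-measurability of the collisional transfer in the datum**: under every measure `μ` on
phase space carried by the good set (`μ Φ.goodᶜ = 0`), `z ↦ W_F(z, h)` is `μ`-a.e. measurable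
(hypotheses of `measurable_collisionalTransfer_comp_subtype`). [folklore] -/
theorem aemeasurable_collisionalTransfer [T2Space X]
    [TopologicalSpace.PseudoMetrizableSpace X] [SecondCountableTopology X] [BorelSpace X]
    (Φ : HardSphereFlow G ε N) (hG : ∀ x : X, Continuous (G.translate x))
    {F F' : Config N d X → E}
    (hF : ∀ z t, HasDerivAt (fun s => F (freeFlight G s z)) (F' (freeFlight G t z)) t)
    (hF' : ∀ z, Continuous fun t => F' (freeFlight G t z)) (hFm : Measurable F)
    (hF'm : StronglyMeasurable F') (h : ℝ) {μ : Measure (Config N d X)} (hμ : μ Φ.goodᶜ = 0) :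
    AEMeasurable (fun z => Φ.collisionalTransfer F z h) μ :=
  Φ.aemeasurable_of_measurable_comp_subtype
    (Φ.measurable_collisionalTransfer_comp_subtype hG hF hF' hFm hF'm h) hμ

/-- A.e.-strong measurability of the collisional transfer in the datum under every measure
carried by the good set (so that Bochner integrals `∫ W_F(z, h) dμ` are meaningful). [folklore] -/
theorem aestronglyMeasurable_collisionalTransfer [T2Space X]
    [TopologicalSpace.PseudoMetrizableSpace X] [SecondCountableTopology X] [BorelSpace X]
    (Φ : HardSphereFlow G ε N) (hG : ∀ x : X, Continuous (G.translate x))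
    {F F' : Config N d X → E}
    (hF : ∀ z t, HasDerivAt (fun s => F (freeFlight G s z)) (F' (freeFlight G t z)) t)
    (hF' : ∀ z, Continuous fun t => F' (freeFlight G t z)) (hFm : Measurable F)
    (hF'm : StronglyMeasurable F') (h : ℝ) {μ : Measure (Config N d X)} (hμ : μ Φ.goodᶜ = 0) :
    AEStronglyMeasurable (fun z => Φ.collisionalTransfer F z h) μ :=
  (Φ.aemeasurable_collisionalTransfer hG hF hF' hFm hF'm h hμ).aestronglyMeasurable

/-- A law absolutely continuous with respect to the Liouville measure is carried by the good
set. [folklore] -/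
theorem measure_compl_good_of_absolutelyContinuous (Φ : HardSphereFlow G ε N)
    {μ : Measure (Config N d X)} (hμ : μ ≪ liouville G N ε) : μ Φ.goodᶜ = 0 :=
  hμ Φ.measure_compl_good

/-- A.e.-measurability of the collisional transfer in the datum under every law absolutely
continuous with respect to the Liouville measure (Gibbs and local Gibbs laws). [folklore] -/
theorem aemeasurable_collisionalTransfer_of_absolutelyContinuous [T2Space X]
    [TopologicalSpace.PseudoMetrizableSpace X] [SecondCountableTopology X] [BorelSpace X]
    (Φ : HardSphereFlow G ε N) (hG : ∀ x : X, Continuous (G.translate x))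
    {F F' : Config N d X → E}
    (hF : ∀ z t, HasDerivAt (fun s => F (freeFlight G s z)) (F' (freeFlight G t z)) t)
    (hF' : ∀ z, Continuous fun t => F' (freeFlight G t z)) (hFm : Measurable F)
    (hF'm : StronglyMeasurable F') (h : ℝ) {μ : Measure (Config N d X)}
    (hμ : μ ≪ liouville G N ε) : AEMeasurable (fun z => Φ.collisionalTransfer F z h) μ :=
  Φ.aemeasurable_collisionalTransfer hG hF hF' hFm hF'm h
    (Φ.measure_compl_good_of_absolutelyContinuous hμ)

/-- Liouville-a.e. measurability of the collisional transfer in the datum. [folklore] -/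
theorem aemeasurable_collisionalTransfer_liouville [T2Space X]
    [TopologicalSpace.PseudoMetrizableSpace X] [SecondCountableTopology X] [BorelSpace X]
    (Φ : HardSphereFlow G ε N) (hG : ∀ x : X, Continuous (G.translate x))
    {F F' : Config N d X → E}
    (hF : ∀ z t, HasDerivAt (fun s => F (freeFlight G s z)) (F' (freeFlight G t z)) t)
    (hF' : ∀ z, Continuous fun t => F' (freeFlight G t z)) (hFm : Measurable F)
    (hF'm : StronglyMeasurable F') (h : ℝ) :
    AEMeasurable (fun z => Φ.collisionalTransfer F z h) (liouville G N ε) :=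
  Φ.aemeasurable_collisionalTransfer hG hF hF' hFm hF'm h Φ.measure_compl_good

end Observable

end HardSphereFlow

end Kinetic

/-! ## On the flat torus: momentum and energy transfer against `C¹` test fields -/

section TorusGeometry

open Literature.Analysis.FunctionSpaces

variable {d : Type*} [Fintype d] {N : ℕ}

/-- Each translation `v ↦ x + proj v` of the torus geometry is continuous (private copy, as in
`CollisionalTransfer`, to keep the imports light). [folklore] -/
private theorem torus_continuous_translate'' (x : UnitAddTorus d) :
    Continuous ((Torus.geometry d).translate x) :=
  continuous_const.add Torus.continuous_proj

/-- The momentum observable `Σ_i ⟪J(x_i), v_i⟫` is continuous for a continuous test field. [folklore] -/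
theorem continuous_momentumObservable {X : Type*} [TopologicalSpace X] {J : X → EuclideanSpace ℝ d}
    (hJ : Continuous J) : Continuous (momentumObservable (N := N) J) := by
  unfold momentumObservable
  refine continuous_finsetSum _ fun i _ => ?_
  have h1 : Continuous fun z : Config N d X => J (z i).1 := hJ.comp (by fun_prop)
  have h2 : Continuous fun z : Config N d X => (z i).2 := by fun_prop
  exact h1.inner h2

/-- The energy observable `Σ_i ϑ(x_i) |v_i|²/2` is continuous for a continuous test field. [folklore] -/
theorem continuous_energyObservable {X : Type*} [TopologicalSpace X] {ϑ : X → ℝ}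
    (hϑ : Continuous ϑ) : Continuous (energyObservable (d := d) (N := N) ϑ) := by
  unfold energyObservable
  refine continuous_finsetSum _ fun i _ => ?_
  have h1 : Continuous fun z : Config N d X => ϑ (z i).1 := hϑ.comp (by fun_prop)
  have h2 : Continuous fun z : Config N d X => (z i).2 := by fun_prop
  exact h1.mul ((h2.norm.pow 2).div_const _)

namespace HardSphereFlow

variable {ε : ℝ}

/-- **Measurability of the collisional momentum transfer in the datum on `T^d`**: for a `C¹`
test field `J : T^d → ℝ^d` and every window length `h`, `z ↦ W_J(z, h) = Φ.momentumTransfer J z h`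
is measurable on the good set of any hard-sphere flow on the flat torus. [folklore] -/
theorem measurable_momentumTransfer_comp_subtype_torus (Φ : HardSphereFlow (Torus.geometry d) ε N)
    {J : UnitAddTorus d → EuclideanSpace ℝ d} (hJ : Torus.IsContDiff 1 J) (h : ℝ) :
    Measurable fun z : Φ.good => Φ.momentumTransfer J z h :=
  Φ.measurable_collisionalTransfer_comp_subtype torus_continuous_translate''
    (hasDerivAt_momentumObservable_freeFlight hJ)
    (fun z => (continuous_momentumStreaming hJ).comp
      (continuous_freeFlight_of_continuous_translate torus_continuous_translate'' z))
    (continuous_momentumObservable hJ.continuous).measurable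
    (continuous_momentumStreaming hJ).stronglyMeasurable h

/-- **Measurability of the collisional energy transfer in the datum on `T^d`**: for a `C¹`
test field `ϑ : T^d → ℝ` and every `h`, `z ↦ W^e_ϑ(z, h) = Φ.energyTransfer ϑ z h` is measurable
on the good set. [folklore] -/
theorem measurable_energyTransfer_comp_subtype_torus (Φ : HardSphereFlow (Torus.geometry d) ε N)
    {ϑ : UnitAddTorus d → ℝ} (hϑ : Torus.IsContDiff 1 ϑ) (h : ℝ) :
    Measurable fun z : Φ.good => Φ.energyTransfer ϑ z h :=
  Φ.measurable_collisionalTransfer_comp_subtype torus_continuous_translate''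
    (hasDerivAt_energyObservable_freeFlight hϑ)
    (fun z => (continuous_energyStreaming hϑ).comp
      (continuous_freeFlight_of_continuous_translate torus_continuous_translate'' z))
    (continuous_energyObservable hϑ.continuous).measurable
    (continuous_energyStreaming hϑ).stronglyMeasurable h

/-- On `T^d`, the collisional momentum transfer against a `C¹` field, extended by `0` off the
good set, is measurable on the whole phase space. [folklore] -/
theorem measurable_indicator_momentumTransfer_torus (Φ : HardSphereFlow (Torus.geometry d) ε N)
    {J : UnitAddTorus d → EuclideanSpace ℝ d} (hJ : Torus.IsContDiff 1 J) (h : ℝ) :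
    Measurable (Φ.good.indicator fun z => Φ.momentumTransfer J z h) :=
  Φ.measurable_indicator_of_measurable_comp_subtype
    (Φ.measurable_momentumTransfer_comp_subtype_torus hJ h)

/-- On `T^d`, the collisional energy transfer against a `C¹` field, extended by `0` off the good
set, is measurable on the whole phase space. [folklore] -/
theorem measurable_indicator_energyTransfer_torus (Φ : HardSphereFlow (Torus.geometry d) ε N)
    {ϑ : UnitAddTorus d → ℝ} (hϑ : Torus.IsContDiff 1 ϑ) (h : ℝ) :
    Measurable (Φ.good.indicator fun z => Φ.energyTransfer ϑ z h) :=
  Φ.measurable_indicator_of_measurable_comp_subtype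
    (Φ.measurable_energyTransfer_comp_subtype_torus hϑ h)

/-- **A.e.-measurability of the collisional momentum transfer on `T^d`** under every measure
carried by the good set (`μ Φ.goodᶜ = 0`; e.g. Gibbs / local Gibbs laws): the hypothesis under
which exponential moments `∫ exp(h⁻¹ W_J(z, h)) dμ` of route statements are taken. [folklore] -/
theorem aemeasurable_momentumTransfer_torus (Φ : HardSphereFlow (Torus.geometry d) ε N)
    {J : UnitAddTorus d → EuclideanSpace ℝ d} (hJ : Torus.IsContDiff 1 J) (h : ℝ)
    {μ : Measure (Config N d (UnitAddTorus d))} (hμ : μ Φ.goodᶜ = 0) :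
    AEMeasurable (fun z => Φ.momentumTransfer J z h) μ :=
  Φ.aemeasurable_of_measurable_comp_subtype (Φ.measurable_momentumTransfer_comp_subtype_torus hJ h) hμ

/-- **A.e.-measurability of the collisional energy transfer on `T^d`** under every measure
carried by the good set. [folklore] -/
theorem aemeasurable_energyTransfer_torus (Φ : HardSphereFlow (Torus.geometry d) ε N)
    {ϑ : UnitAddTorus d → ℝ} (hϑ : Torus.IsContDiff 1 ϑ) (h : ℝ)
    {μ : Measure (Config N d (UnitAddTorus d))} (hμ : μ Φ.goodᶜ = 0) :
    AEMeasurable (fun z => Φ.energyTransfer ϑ z h) μ :=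
  Φ.aemeasurable_of_measurable_comp_subtype (Φ.measurable_energyTransfer_comp_subtype_torus hϑ h) hμ

/-- On `T^d`, the collisional momentum transfer against a `C¹` field is a.e.-measurable under
every law absolutely continuous with respect to the Liouville measure. [folklore] -/
theorem aemeasurable_momentumTransfer_torus_of_absolutelyContinuous
    (Φ : HardSphereFlow (Torus.geometry d) ε N) {J : UnitAddTorus d → EuclideanSpace ℝ d}
    (hJ : Torus.IsContDiff 1 J) (h : ℝ) {μ : Measure (Config N d (UnitAddTorus d))}
    (hμ : μ ≪ liouville (Torus.geometry d) N ε) :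
    AEMeasurable (fun z => Φ.momentumTransfer J z h) μ :=
  Φ.aemeasurable_momentumTransfer_torus hJ h (Φ.measure_compl_good_of_absolutelyContinuous hμ)

/-- On `T^d`, the collisional energy transfer against a `C¹` field is a.e.-measurable under
every law absolutely continuous with respect to the Liouville measure. [folklore] -/
theorem aemeasurable_energyTransfer_torus_of_absolutelyContinuous
    (Φ : HardSphereFlow (Torus.geometry d) ε N) {ϑ : UnitAddTorus d → ℝ}
    (hϑ : Torus.IsContDiff 1 ϑ) (h : ℝ) {μ : Measure (Config N d (UnitAddTorus d))}
    (hμ : μ ≪ liouville (Torus.geometry d) N ε) :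
    AEMeasurable (fun z => Φ.energyTransfer ϑ z h) μ :=
  Φ.aemeasurable_energyTransfer_torus hϑ h (Φ.measure_compl_good_of_absolutelyContinuous hμ)

/-- Liouville-a.e. measurability of the collisional momentum transfer on `T^d`. [folklore] -/
theorem aemeasurable_momentumTransfer_torus_liouville (Φ : HardSphereFlow (Torus.geometry d) ε N)
    {J : UnitAddTorus d → EuclideanSpace ℝ d} (hJ : Torus.IsContDiff 1 J) (h : ℝ) :
    AEMeasurable (fun z => Φ.momentumTransfer J z h) (liouville (Torus.geometry d) N ε) :=
  Φ.aemeasurable_momentumTransfer_torus hJ h Φ.measure_compl_good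

/-- Liouville-a.e. measurability of the collisional energy transfer on `T^d`. [folklore] -/
theorem aemeasurable_energyTransfer_torus_liouville (Φ : HardSphereFlow (Torus.geometry d) ε N)
    {ϑ : UnitAddTorus d → ℝ} (hϑ : Torus.IsContDiff 1 ϑ) (h : ℝ) :
    AEMeasurable (fun z => Φ.energyTransfer ϑ z h) (liouville (Torus.geometry d) N ε) :=
  Φ.aemeasurable_energyTransfer_torus hϑ h Φ.measure_compl_good

end HardSphereFlow

end TorusGeometry

end

end Literature.Analysis.FluidPDE
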